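import Summits.HodgeConjecture.HodgeConjecture.Theorems.H413MirrorSplittingAtScalar
import Summits.HodgeConjecture.CorCM.B01.Transposition.Item6OmegaChiSplitting
import Literature.NumberTheory.Automorphic.Liu2021.Def411WeilCarriersAtLine
import Literature.NumberTheory.Automorphic.Liu2021.Def411ChiGaloisTwist
import Literature.NumberTheory.Automorphic.Liu2021.Def411WeilCarriersFrameTransport
import HarnessLib

/-!
# FLOOR-0 P4, stub S5 (`stub_T3b_conjugatePartnerAt`), piece (J-c): AT THE PIN'S LINE DATA `(TW a, JW a)` — the conjugate partner of
# `ω(μ, ⟨a⟩, χ)` is `ω(μ', ⟨−a⟩, χ̄)`, conjugate-linearly and `U(V)(𝔸_f)`-equivariantly, `μ'` of weight one with `Φ_{μ'} = Φ̄_μ`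

Cell hodgecm-mathlib, crux item H413 = stmt-HodgeConjecture-24833, P4 line `Cruxes/H413/Lines/F0_P4AdmissibleOccursInH1.lean`, stub S5.
Sequel of ★ `Theorems/H413WeilFinRepMirror` (J-a: the mirror splitting, its operator law, the conjugate-linear map of central coinvariants) and
★ `Theorems/H413MirrorSplittingAtScalar` (J-b: in the scalar currency `SplittingAt V a`, the mirror of `ι_μ` is `ι_{μ'}`).  The pin's
`ω_V(t)` ([Liu2021, Def. 4.11]) is `omegaAtLine … (hsChiD … (toHecke t.μ) …) a t.χ` at the line data `(TW a, JW a)` of a unit `a : (L⁺)ˣ`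
(★ `Transposition/Item6UniformOmegaRep`, `Liu2021/Def411WeilCarriersAtLine`).  This file moves J-a∕J-b to that currency:

* §1 the junction of currencies: `TW a = realDiagonal (vec â)`, `JW a = diag (vec â)` for the scalar `â = (a : L)` (and `−a ↦ â'`, `â'.1 = −â.1`);
  casts `chiSplittingLine`∕`mirrorSplitting`∕`splittingCongr` commute (`subst`).
* §2 **`exists_weightOne_mirror_sChiD`**: the mirror of the pin's splitting `sChiD (toHecke μ) a`, read at `(TW (−a), JW (−a))`, IS `sChiD (toHecke μ') (−a)`
  for some `μ'` conjugate symplectic OF WEIGHT ONE with `HasCMType μ' Φ̄_μ` (J-b + §1).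
* §3 `exists_coinv_semilinear_mirror_cast` (J-a read along equal W-data) and the line-character identity
  `lineChar (−a) χ̄ ū = conj (lineChar a χ u)` (`χ̄ := conj ∘ χ`, automorphic by ★ `isAutomorphicOneChar_unitsMap_comp_chi`).
* §4 **`exists_conjPartner_omegaAtLine_neg`** — FOR EVERY weight-one conjugate-symplectic `μ` with CM type `Φ`, unit `a` and `χ ∈ Chi`: some `μ'`
  (weight one, `Φ_{μ'} = Φ̄`) and a BIJECTIVE CONJUGATE-LINEAR `J : ω(μ, ⟨a⟩, χ) → ω(μ', ⟨−a⟩, χ̄)` with `J ∘ rhoVAtLine a χ k = rhoVAtLine (−a) χ̄ k ∘ J`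
  for every `k ∈ U(V)(𝔸_f)` — [Liu2021, App. D Lem. D.1 (2)] «`\overline{ω(μ,ε,χ)} ≅ ω(μᶜ, −ε, χ⁻¹)`» at the tree's construction, AT THE
  MIRROR REPRESENTATIVE `−a` of the class `−ε`.

WHAT S5 STILL NEEDS after this file (census F0P4-p03 2026-08-31T00:4xZ): (J-d) REPRESENTATIVE INDEPENDENCE — the datum's partner triple `t'`
lives on `⟨r ε'⟩`, `r ε' = lineOf ε' ≠ −a` in general (same FINITE local norm classes, uncontrolled real signs), so an equivariant
`ω(μ', ⟨−a⟩, χ̄) ≃ ω(μ', ⟨r ε'⟩, χ̄)` for `locF (−a) = locF (r ε')` is required ([Liu2021, App. D §D.1 Step 1 footnote]); it is not in the tree.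
THEOREMS ONLY (no definition, no named fact, no instance, no `sorry`).  HC_CM is proved only modulo the printed citations until rung 0 closes;
this file proves nothing about them.

References: [Liu2021] Y. Liu, Camb. J. Math. 9 (2021), Def. 4.11–4.12, Rem. 4.4, App. D §D.1 Steps 1–3 (l. 5215–5221), Lem. D.1 (2) (l. 5231);
[GelbartRogawski1991] Invent. Math. 105 (1991), §3.1 Prop. 3.1.1 p. 455, Remark p. 457; [Li1992] J. reine angew. Math. 428 (1992), p. 181;
[Kudla1994] Israel J. Math. 87 (1994), §2; [MoeglinVignerasWaldspurger1987] LNM 1291, Chap. 2 II.1, Chap. 3 IV.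
-/

set_option autoImplicit false
set_option linter.dupNamespace false

noncomputable section

namespace Summit.HodgeConjecture.HodgeConjecture.Cruxes.H413.MirrorAtPinLine

open NumberField NumberField.InfinitePlace NumberField.ComplexEmbedding NumberField.mixedEmbedding IsDedekindDomain
open scoped Matrix SchwartzMap Classical TensorProduct ComplexConjugate
open Literature.RepresentationTheory
open Literature.NumberTheory.Automorphic Literature.NumberTheory.Automorphic.UnitaryGroup Literature.NumberTheory.Weil1964
open Literature.NumberTheory.GelbartRogawski1991 Literature.NumberTheory.GelbartRogawski1991.UnitaryDualPair
open Literature.NumberTheory.GelbartRogawski1991.UnitaryDualPair.WeilCoinv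
open Literature.NumberTheory.GelbartRogawski1991.GRConstruction
open Literature.NumberTheory.Automorphic.Liu2021.Def411WeilCarriersDoubling
open Literature.NumberTheory.Automorphic.Liu2021.Def411WeilCarriers
open Literature.NumberTheory.Automorphic.IdeleClassGroup
open Literature.NumberTheory.GaloisRepresentations
open Literature.NumberTheory.ComplexMultiplication.CMTypeOps (bar mem_bar_iff)
open Literature.RepresentationTheory.HarrisKudlaSweet1996
open HodgeCM HodgeCM.Model HodgeCM.Model.LiuIndex
open HodgeCM.Model.ArchSideTerm (e₁)
open Summit.HodgeConjecture.CorCM.Transposition.OmegaChiSplitting (sChiD hsChiD)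
open Summit.HodgeConjecture.HodgeConjecture.Cruxes.H413.WeilFinRepMirror
open Summit.HodgeConjecture.HodgeConjecture.Cruxes.H413.MirrorAtScalar
open HodgeCM.WeilCoinv (mirrorSplitting)

/-! ## §1 Junction of currencies and casts -/

section Casts

variable (F E : Type) [Field F] [NumberField F] [Field E] [NumberField E] [Algebra F E]
variable (c : E ≃ₐ[F] E) (N M : ℕ) {n : ℕ} (e : Fin N × Fin M ≃ Fin n)
variable (JV : Matrix (Fin N) (Fin N) E) {TV : Matrix (Fin N) (Fin N) F}

/-- casts compose: `splittingCongr h₂ (splittingCongr h₁ s) = splittingCongr (h₁ ⬝ h₂) s`. [cite: GelbartRogawski1991, §3.1 Prop. 3.1.1 p. 455 L1–3] -/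
theorem splittingCongr_splittingCongr {TW₁ TW₂ TW₃ : Matrix (Fin M) (Fin M) F} {JW₁ JW₂ JW₃ : Matrix (Fin M) (Fin M) E}
    (h₁T : TW₁ = TW₂) (h₁J : JW₁ = JW₂) (h₂T : TW₂ = TW₃) (h₂J : JW₂ = JW₃)
    (s : adelicPair F E c N M JV JW₁ →* adelicMpCont F (Fin n) (adelicGram F e TV TW₁)) :
    splittingCongr F E c N M e JV h₂T h₂J (splittingCongr F E c N M e JV h₁T h₁J s) =
      splittingCongr F E c N M e JV (h₁T.trans h₂T) (h₁J.trans h₂J) s := by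
  subst h₁T h₁J h₂T h₂J
  rfl

/-- the mirror splitting commutes with casts: `mirror (splittingCongr hT hJ s) = splittingCongr (−hT) (−hJ) (mirror s)`. [cite: Kudla1994, §2] -/
theorem mirrorSplitting_splittingCongr {TW₁ TW₂ : Matrix (Fin M) (Fin M) F} {JW₁ JW₂ : Matrix (Fin M) (Fin M) E}
    (hT : TW₁ = TW₂) (hJ : JW₁ = JW₂) (s : adelicPair F E c N M JV JW₁ →* adelicMpCont F (Fin n) (adelicGram F e TV TW₁)) :
    mirrorSplitting F E c N M e JV JW₂ (splittingCongr F E c N M e JV hT hJ s) =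
      splittingCongr F E c N M e JV (congrArg Neg.neg hT) (congrArg Neg.neg hJ) (mirrorSplitting F E c N M e JV JW₁ s) := by
  subst hT hJ
  rfl

end Casts


section Scalar

variable {L : CMField}

/-- **the junction `TW a = realDiagonal (vec â)`**: the pin's `1 × 1` Gram matrix `(a)` of the line `⟨a⟩` is the scalar currency's
`realDiagonal` of the Gram vector of `â = (a : L)`. [cite: Liu2021, App. D §D.1 Step 1 (l. 5217)] -/
theorem TW_eq_realDiagonal (a : (↥(maximalRealSubfield (L : Type)))ˣ) (â : RealScalar L) (hâ : â.1 = ((a : ↥(maximalRealSubfield (L : Type))) : (L : Type))) :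
    TW ↥(maximalRealSubfield (L : Type)) a = realDiagonal (L : Type) (RealScalar.vec â) (RealScalar.vec_real â) := by
  refine Matrix.ext fun i j => ?_
  rw [Subsingleton.elim i 0, Subsingleton.elim j 0, realDiagonal, Matrix.diagonal_apply_eq]
  refine Subtype.ext ?_
  show (((a : ↥(maximalRealSubfield (L : Type))) : (L : Type))) = RealScalar.vec â 0
  rw [RealScalar.vec_zero, hâ]

/-- … and `JW a = diag (vec â)`. [cite: Liu2021, App. D §D.1 Step 1 (l. 5217)] -/
theorem JW_eq_diagonal (a : (↥(maximalRealSubfield (L : Type)))ˣ) (â : RealScalar L) (hâ : â.1 = ((a : ↥(maximalRealSubfield (L : Type))) : (L : Type))) :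
    JW ↥(maximalRealSubfield (L : Type)) (L : Type) a = Matrix.diagonal (RealScalar.vec â) := by
  rw [JW_eq, TW_eq_realDiagonal a â hâ, realDiagonal_map]

/-- the mirror unit `−a` has scalar `â'` with `â'.1 = −â.1`. [cite: Liu2021, Definition 4.12] -/
theorem coe_neg_unit (a : (↥(maximalRealSubfield (L : Type)))ˣ) (â â' : RealScalar L)
    (hâ : â.1 = ((a : ↥(maximalRealSubfield (L : Type))) : (L : Type))) (hâ' : â'.1 = -â.1) :
    â'.1 = (((-a : (↥(maximalRealSubfield (L : Type)))ˣ) : ↥(maximalRealSubfield (L : Type))) : (L : Type)) := by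
  rw [hâ', hâ, Units.val_neg, NegMemClass.coe_neg]

end Scalar

/-! ## §2 The mirror of the pin's splitting `sChiD (toHecke μ) a` is `sChiD (toHecke μ') (−a)` -/

section PinSplitting

variable {L : CMField} {ι₁ : (L : Type) →+* ℂ} (V : HermSpace3 L ι₁)

/-- `−TW a = TW (−a)`. [cite: Liu2021, App. D §D.1 Step 1 (l. 5215)] -/
theorem neg_TW_eq (a : (↥(maximalRealSubfield (L : Type)))ˣ) :
    -TW ↥(maximalRealSubfield (L : Type)) a = TW ↥(maximalRealSubfield (L : Type)) (-a) := by
  refine Matrix.ext fun i j => ?_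
  rw [Subsingleton.elim i 0, Subsingleton.elim j 0, Matrix.neg_apply]
  show -((a : ↥(maximalRealSubfield (L : Type)))) = (((-a : (↥(maximalRealSubfield (L : Type)))ˣ)) : ↥(maximalRealSubfield (L : Type)))
  rw [Units.val_neg]

/-- `−JW a = JW (−a)`. [cite: Liu2021, App. D §D.1 Step 1 (l. 5215)] -/
theorem neg_JW_eq (a : (↥(maximalRealSubfield (L : Type)))ˣ) :
    -JW ↥(maximalRealSubfield (L : Type)) (L : Type) a = JW ↥(maximalRealSubfield (L : Type)) (L : Type) (-a) := by
  rw [JW_eq, JW_eq, ← neg_TW_eq, Matrix.map_neg _ (map_neg _)]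

set_option maxHeartbeats 4000000 in
/-- **the pin's splitting is a cast of the scalar currency's `chiSplitting`**: for a unit `a` of `L⁺` and the scalar `â = (a : L)`,
`sChiD χ a = splittingCongr _ _ (chiSplitting χ (vec â))` (`sChiD` unfolds to `chiSplittingLine` at `(TW a, JW a)`, a cast of
`chiSplitting (lineW (TW a))`, and `lineW (TW a) = vec â`: ★ `splittingCongr_chiSplitting_of_eq`). [cite: GelbartRogawski1991, §3.1 Prop. 3.1.1 p. 455 L1–3]
[cite: Liu2021, App. D §D.1 Steps 1–2 (l. 5217–5219)] -/
theorem sChiD_eq_splittingCongr_chiSplitting (χ : HeckeCharacter (L : Type)) (hχu : χ.IsUnitary) (hχs : IsSplittingChar (L : Type) 1 χ)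
    (a : (↥(maximalRealSubfield (L : Type)))ˣ) (â : RealScalar L) (hâ : â.1 = ((a : ↥(maximalRealSubfield (L : Type))) : (L : Type))) :
    sChiD (⟨HodgeCM.CMField.K L⟩ : Summit.HodgeConjecture.CorCM.CMField) e₁ (frameD V) (frameD_real V) (frameD_ne V) χ hχu hχs a =
      splittingCongr ↥(maximalRealSubfield (L : Type)) (L : Type) (IsCMField.complexConj (L : Type)) 3 1 e₁ (Matrix.diagonal (frameD V))
        (TW_eq_realDiagonal a â hâ).symm (JW_eq_diagonal a â hâ).symm
        (chiSplitting (L : Type) e₁ (frameD V) (frameD_real V) (frameD_ne V) (RealScalar.vec â) (RealScalar.vec_real â) (RealScalar.vec_ne â)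
          χ hχu hχs) := by
  have hl : RealScalar.vec â = lineW (L : Type) (TW ↥(maximalRealSubfield (L : Type)) a) := funext fun i => by
    rw [Subsingleton.elim i 0, RealScalar.vec_zero, hâ]
    rfl
  have hT₂ : realDiagonal (L : Type) (RealScalar.vec â) (RealScalar.vec_real â) =
      realDiagonal (L : Type) (lineW (L : Type) (TW ↥(maximalRealSubfield (L : Type)) a))
        (complexConj_lineW (L : Type) (TW ↥(maximalRealSubfield (L : Type)) a)) := by
    unfold realDiagonal; congr 1; funext i; exact Subtype.ext (congrFun hl i)
  have hJ₂ : Matrix.diagonal (RealScalar.vec â) = Matrix.diagonal (lineW (L : Type) (TW ↥(maximalRealSubfield (L : Type)) a)) := by rw [hl]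
  have e2 := splittingCongr_chiSplitting_of_eq (L : Type) e₁ (frameD V) (frameD_real V) (frameD_ne V) χ hχu hχs (RealScalar.vec_real â)
    (complexConj_lineW (L : Type) (TW ↥(maximalRealSubfield (L : Type)) a)) (RealScalar.vec_ne â)
    (lineW_ne_zero (L : Type) (TW ↥(maximalRealSubfield (L : Type)) a) (isUnit_det_TW ↥(maximalRealSubfield (L : Type)) a)) hl hT₂ hJ₂
  -- `sChiD χ a` unfolds to the cast of `chiSplitting χ (lineW (TW a))`; substitute `e2` and compose the casts
  show splittingCongr ↥(maximalRealSubfield (L : Type)) (L : Type) (IsCMField.complexConj (L : Type)) 3 1 e₁ (Matrix.diagonal (frameD V))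
      (realDiagonal_lineW (L : Type) (TW ↥(maximalRealSubfield (L : Type)) a))
      (diagonal_lineW (L : Type) (TW ↥(maximalRealSubfield (L : Type)) a) (JW_eq ↥(maximalRealSubfield (L : Type)) (L : Type) a))
      (chiSplitting (L : Type) e₁ (frameD V) (frameD_real V) (frameD_ne V) (lineW (L : Type) (TW ↥(maximalRealSubfield (L : Type)) a))
        (complexConj_lineW (L : Type) (TW ↥(maximalRealSubfield (L : Type)) a))
        (lineW_ne_zero (L : Type) (TW ↥(maximalRealSubfield (L : Type)) a) (isUnit_det_TW ↥(maximalRealSubfield (L : Type)) a)) χ hχu hχs) = _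
  exact (congrArg (splittingCongr ↥(maximalRealSubfield (L : Type)) (L : Type) (IsCMField.complexConj (L : Type)) 3 1 e₁ (Matrix.diagonal (frameD V))
      (realDiagonal_lineW (L : Type) (TW ↥(maximalRealSubfield (L : Type)) a))
      (diagonal_lineW (L : Type) (TW ↥(maximalRealSubfield (L : Type)) a) (JW_eq ↥(maximalRealSubfield (L : Type)) (L : Type) a))) e2.symm).trans
    (splittingCongr_splittingCongr ↥(maximalRealSubfield (L : Type)) (L : Type) (IsCMField.complexConj (L : Type)) 3 1 e₁ (Matrix.diagonal (frameD V))
      hT₂ hJ₂ _ _ _)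

set_option maxHeartbeats 16000000 in
-- (six casts through the `splittingDatum` telescope; each `rw` motive is re-checked)
/-- **THE MIRROR OF THE PIN'S SPLITTING**: for `μ` conjugate symplectic of weight one with CM type `Φ` and every unit `a` of `L⁺`, the mirror of the
`χ`-attached splitting `sChiD (toHecke μ) a` of [GelbartRogawski1991, Prop. 3.1.1], read at the line data of `−a`, IS `sChiD (toHecke μ') (−a)` for some
`μ'` conjugate symplectic OF WEIGHT ONE with `HasCMType μ' Φ̄` (★ `exists_weightOne_eq_chiSplittingLine_mirror_chiSplittingLine` + the junction §1).
[cite: Liu2021, App. D Lemma D.1 (2) (l. 5231), Remark 4.4, Definition 4.12] [cite: GelbartRogawski1991, §3.1 Prop. 3.1.1 p. 455, Remark p. 457 L4–13] -/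
theorem exists_weightOne_mirror_sChiD
    (μ : Literature.NumberTheory.Automorphic.IdeleClassGroup (L : Type) →ₜ* Circle) (hμ : IsConjugateSymplectic (L : Type) μ)
    (hw : HasWeight (L : Type) μ 1) {Φ : Literature.AlgebraicGeometry.Motives.CMType (L : Type)} (hΦμ : HasCMType (L : Type) μ Φ)
    (a : (↥(maximalRealSubfield (L : Type)))ˣ) :
    ∃ (μ' : Literature.NumberTheory.Automorphic.IdeleClassGroup (L : Type) →ₜ* Circle) (hμ' : IsConjugateSymplectic (L : Type) μ'),
      HasWeight (L : Type) μ' 1 ∧ HasCMType (L : Type) μ' (bar Φ) ∧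
        splittingCongr ↥(maximalRealSubfield (L : Type)) (L : Type) (IsCMField.complexConj (L : Type)) 3 1 e₁ (Matrix.diagonal (frameD V))
            (neg_TW_eq a) (neg_JW_eq a)
            (mirrorSplitting ↥(maximalRealSubfield (L : Type)) (L : Type) (IsCMField.complexConj (L : Type)) 3 1 e₁ (Matrix.diagonal (frameD V))
              (JW ↥(maximalRealSubfield (L : Type)) (L : Type) a)
              (sChiD (⟨HodgeCM.CMField.K L⟩ : Summit.HodgeConjecture.CorCM.CMField) e₁ (frameD V) (frameD_real V) (frameD_ne V)
                (toHeckeCharacter (L : Type) μ) (isUnitary_toHeckeCharacter (L : Type) μ)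
                (isSplittingChar_toHeckeCharacter_of_isConjugateSymplectic (L : Type) μ hμ) a)) =
          sChiD (⟨HodgeCM.CMField.K L⟩ : Summit.HodgeConjecture.CorCM.CMField) e₁ (frameD V) (frameD_real V) (frameD_ne V)
            (toHeckeCharacter (L : Type) μ') (isUnitary_toHeckeCharacter (L : Type) μ')
            (isSplittingChar_toHeckeCharacter_of_isConjugateSymplectic (L : Type) μ' hμ') (-a) := by
  -- the two scalars `â = (a : L)`, `â' = −â` (opaque locals)
  obtain ⟨â, hâ⟩ : ∃ â : RealScalar L, â.1 = ((a : ↥(maximalRealSubfield (L : Type))) : (L : Type)) :=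
    ⟨⟨((a : ↥(maximalRealSubfield (L : Type))) : (L : Type)),
      (IsCMField.complexConj_eq_self_iff (K := (L : Type)) _).2 (a : ↥(maximalRealSubfield (L : Type))).2,
      fun h => a.ne_zero (Subtype.ext h)⟩, rfl⟩
  obtain ⟨â', hâ'⟩ : ∃ â' : RealScalar L, â'.1 = -â.1 := ⟨⟨-â.1, by rw [map_neg, â.2.1], neg_ne_zero.2 â.2.2⟩, rfl⟩
  obtain ⟨μ', hμ', hw', hΦ', hEq⟩ := exists_weightOne_eq_chiSplittingLine_mirror_chiSplittingLine V hâ' μ hμ hw hΦμ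
  refine ⟨μ', hμ', hw', hΦ', ?_⟩
  -- both `sChiD`s are casts of `chiSplitting` at `vec â`, `vec â'`; the scalar `chiSplittingLine`s in `hEq` ARE those `chiSplitting`s
  have h1 := sChiD_eq_splittingCongr_chiSplitting V (toHeckeCharacter (L : Type) μ) (isUnitary_toHeckeCharacter (L : Type) μ)
    (isSplittingChar_toHeckeCharacter_of_isConjugateSymplectic (L : Type) μ hμ) a â hâ
  have h2 := sChiD_eq_splittingCongr_chiSplitting V (toHeckeCharacter (L : Type) μ') (isUnitary_toHeckeCharacter (L : Type) μ')
    (isSplittingChar_toHeckeCharacter_of_isConjugateSymplectic (L : Type) μ' hμ') (-a) â' (coe_neg_unit a â â' hâ hâ')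
  have h1c := chiSplittingLine_realDiagonal (L : Type) (toHeckeCharacter (L : Type) μ) (isUnitary_toHeckeCharacter (L : Type) μ)
    (isSplittingChar_toHeckeCharacter_of_isConjugateSymplectic (L : Type) μ hμ) e₁ (frameD V) (frameD_real V) (frameD_ne V)
    (RealScalar.vec â) (RealScalar.vec_real â) (RealScalar.vec_ne â)
    (isUnit_det_realDiagonal (L : Type) (RealScalar.vec â) (RealScalar.vec_real â) (RealScalar.vec_ne â))
    (realDiagonal_map (L : Type) (RealScalar.vec â) (RealScalar.vec_real â)).symm
  have h2c := chiSplittingLine_realDiagonal (L : Type) (toHeckeCharacter (L : Type) μ') (isUnitary_toHeckeCharacter (L : Type) μ')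
    (isSplittingChar_toHeckeCharacter_of_isConjugateSymplectic (L : Type) μ' hμ') e₁ (frameD V) (frameD_real V) (frameD_ne V)
    (RealScalar.vec â') (RealScalar.vec_real â') (RealScalar.vec_ne â')
    (isUnit_det_realDiagonal (L : Type) (RealScalar.vec â') (RealScalar.vec_real â') (RealScalar.vec_ne â'))
    (realDiagonal_map (L : Type) (RealScalar.vec â') (RealScalar.vec_real â')).symm
  -- `hEq` read on the `chiSplitting`s: `splittingCongr _ _ (mirror (chiSplitting μ (vec â))) = chiSplitting μ' (vec â')`
  have hEq' := (congrArg (fun s => splittingCongr ↥(maximalRealSubfield (L : Type)) (L : Type) (IsCMField.complexConj (L : Type)) 3 1 e₁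
      (Matrix.diagonal (frameD V)) (realDiagonal_vec_eq_neg hâ').symm (diagonal_vec_eq_neg hâ').symm
      (mirrorSplitting ↥(maximalRealSubfield (L : Type)) (L : Type) (IsCMField.complexConj (L : Type)) 3 1 e₁ (Matrix.diagonal (frameD V))
        (Matrix.diagonal (RealScalar.vec â)) s)) h1c).symm.trans (hEq.trans h2c)
  -- LHS: mirror of a cast = cast of the mirror, casts compose
  rw [h1, h2, mirrorSplitting_splittingCongr, splittingCongr_splittingCongr, ← hEq', splittingCongr_splittingCongr]

end PinSplitting

/-! ## §3 The conjugate-linear coinvariant map read along equal W-data; the line character -/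

section Cast

variable (F E : Type) [Field F] [NumberField F] [Field E] [NumberField E] [Algebra F E]
variable (c : E ≃ₐ[F] E) (N M : ℕ) {n : ℕ} (e : Fin N × Fin M ≃ Fin n)
variable (JV : Matrix (Fin N) (Fin N) E) (JW : Matrix (Fin M) (Fin M) E)
variable {TV : Matrix (Fin N) (Fin N) F} {TW : Matrix (Fin M) (Fin M) F}
variable [Algebra.IsQuadraticExtension F E] {δ : E} (hcδ : c δ = -δ) (hδ : δ ≠ 0) {d : F}
  (hd : δ * δ = algebraMap F E d) (hV : TV.IsSymm) (hW : TW.IsSymm) (hVd : IsUnit TV.det) (hWd : IsUnit TW.det)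
  (hJV : JV = TV.map (algebraMap F E)) (hJW : JW = TW.map (algebraMap F E))
  {s : adelicPair F E c N M JV JW →* adelicMpCont F (Fin n) (adelicGram F e TV TW)}

/-- **J-a READ ALONG EQUAL W-DATA**: for W-data `(TW₂, JW₂) = (−TW, −JW)` and a splitting `s₂` there EQUAL to the cast of the mirror of `s`,
complex conjugation descends to a bijective conjugate-linear map `Ω(s, χ) → Ω(s₂, χ₂)` intertwining `weilCoinv` at the SAME `k ∈ U(J_V)(𝔸_f)`,
for any `χ₂` with `χ₂ u₂ = conj (χ u)` whenever `u₂`, `u` have the same matrix (★ `exists_coinv_semilinear_mirror`, `subst`).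
[cite: Liu2021, App. D Lemma D.1 (2) (l. 5231)] [cite: Li1992, p. 181] [cite: MoeglinVignerasWaldspurger1987, Chap. 3 IV] -/
theorem exists_coinv_semilinear_mirror_cast (hs : (splittingDatum F E c N M e JV JW hcδ hδ hd hV hW hVd hWd hJV hJW).IsCompatible s)
    {TW₂ : Matrix (Fin M) (Fin M) F} {JW₂ : Matrix (Fin M) (Fin M) E} (hT : -TW = TW₂) (hJ : -JW = JW₂)
    (hW₂ : TW₂.IsSymm) (hWd₂ : IsUnit TW₂.det) (hJW₂ : JW₂ = TW₂.map (algebraMap F E))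
    (s₂ : adelicPair F E c N M JV JW₂ →* adelicMpCont F (Fin n) (adelicGram F e TV TW₂))
    (hss : splittingCongr F E c N M e JV hT hJ (mirrorSplitting F E c N M e JV JW s) = s₂)
    (hs₂ : (splittingDatum F E c N M e JV JW₂ hcδ hδ hd hV hW₂ hVd hWd₂ hJV hJW₂).IsCompatible s₂)
    (χ : finAdelic F E c M JW →* ℂˣ) (χ₂ : finAdelic F E c M JW₂ →* ℂˣ)
    (hχ₂ : ∀ (u : finAdelic F E c M JW) (u₂ : finAdelic F E c M JW₂),
      ((u₂ : GL (Fin M) (FiniteAdeleRing (𝓞 E) E)) : Matrix (Fin M) (Fin M) (FiniteAdeleRing (𝓞 E) E)) =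
        (u : GL (Fin M) (FiniteAdeleRing (𝓞 E) E)) → ((χ₂ u₂ : ℂˣ) : ℂ) = conj ((χ u : ℂˣ) : ℂ)) :
    ∃ J : Literature.RepresentationTheory.TwistedCoinv.Coinv (finPairRepW F E c N M e JV JW hcδ hδ hd hV hW hVd hWd hJV hJW hs) χ →ₛₗ[starRingEnd ℂ]
        Literature.RepresentationTheory.TwistedCoinv.Coinv (finPairRepW F E c N M e JV JW₂ hcδ hδ hd hV hW₂ hVd hWd₂ hJV hJW₂ hs₂) χ₂,
      Function.Bijective J ∧
      (∀ f, J (Literature.RepresentationTheory.TwistedCoinv.mk _ χ f) = Literature.RepresentationTheory.TwistedCoinv.mk _ χ₂ (finSBConj f)) ∧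
      ∀ (k : finAdelic F E c N JV) (x : Literature.RepresentationTheory.TwistedCoinv.Coinv (finPairRepW F E c N M e JV JW hcδ hδ hd hV hW hVd hWd hJV hJW hs) χ),
        J (weilCoinv F E c N M e JV JW hcδ hδ hd hV hW hVd hWd hJV hJW χ hs k x) =
          weilCoinv F E c N M e JV JW₂ hcδ hδ hd hV hW₂ hVd hWd₂ hJV hJW₂ χ₂ hs₂ k (J x) := by
  subst hT hJ hss
  exact exists_coinv_semilinear_mirror F E c N M e JV JW hcδ hδ hd hV hW hVd hWd hJV hJW hs χ χ₂ fun u =>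
    hχ₂ u (finAdelicNeg F E c M JW u) (congrArg Units.val (coe_finAdelicNeg F E c M JW u))

end Cast

section LineChar

variable (F E : Type) [Field F] [NumberField F] [Field E] [NumberField E] [Algebra F E] (c : E ≃ₐ[F] E)

omit [NumberField F] in
/-- **the line character does not see the representative**: `χ'_W(u₂) = χ'(u₀)` where `u = u₀·1_W`, for `u₂ ∈ U(J_W(b))(𝔸_f)` with the matrix of
`u ∈ U(J_W(a))(𝔸_f)` — in particular for the conjugate character `lineChar b (conj ∘ χ) u₂ = conj (lineChar a χ u)`.
[cite: Liu2021, App. D §D.1 Step 3 (l. 5221)] -/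
theorem lineChar_eq_of_val_eq (a b : Fˣ) (χ : finAdelicOne F E c →* ℂˣ) (τ : ℂ →* ℂ)
    (u : finAdelic F E c 1 (JW F E a)) (u₂ : finAdelic F E c 1 (JW F E b))
    (hu : ((u₂ : GL (Fin 1) (FiniteAdeleRing (𝓞 E) E)) : Matrix (Fin 1) (Fin 1) (FiniteAdeleRing (𝓞 E) E)) =
      (u : GL (Fin 1) (FiniteAdeleRing (𝓞 E) E))) :
    ((lineChar F E c b ((Units.map τ).comp χ) u₂ : ℂˣ) : ℂ) = τ ((lineChar F E c a χ u : ℂˣ) : ℂ) := by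
  -- `(lineCenterEquiv b).symm u₂ = (lineCenterEquiv a).symm u =: u₀` (both are `u₀` with `u₀ • 1 =` the common matrix)
  have key : (lineCenterEquiv F E c b).symm u₂ = (lineCenterEquiv F E c a).symm u := by
    apply (lineCenterEquiv F E c b).injective
    rw [MulEquiv.apply_symm_apply]
    apply Subtype.ext
    apply Units.ext
    rw [hu, lineCenterEquiv_apply, coe_finAdelicCenter]
    conv_lhs => rw [← (lineCenterEquiv F E c a).apply_symm_apply u]
    rw [lineCenterEquiv_apply, coe_finAdelicCenter]
  change ((((Units.map τ).comp χ) ((lineCenterEquiv F E c b).symm u₂) : ℂˣ) : ℂ) = τ ((χ ((lineCenterEquiv F E c a).symm u) : ℂˣ) : ℂ)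
  rw [key, MonoidHom.comp_apply, Units.coe_map]

end LineChar

/-! ## §4 The conjugate partner of `ω(μ, ⟨a⟩, χ)` at the mirror representative -/

section Partner

variable {L : CMField} {ι₁ : (L : Type) →+* ℂ} (V : HermSpace3 L ι₁)

set_option maxHeartbeats 4000000 in
/-- **THE CONJUGATE PARTNER AT THE MIRROR LINE.**  For every `μ` conjugate symplectic OF WEIGHT ONE with CM type `Φ`, every unit `a ∈ (L⁺)ˣ` and
every automorphic `χ ∈ Chi`: there are `μ'` conjugate symplectic OF WEIGHT ONE with `HasCMType μ' Φ̄` and a BIJECTIVE CONJUGATE-LINEAR map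
`J : ω(μ, ⟨a⟩, χ) → ω(μ', ⟨−a⟩, χ̄)` (`χ̄ = conj ∘ χ`; the carriers `omegaAtLine` of [Liu2021, Def. 4.11] at the `χ`-attached splittings `sChiD`)
with `J (rhoVAtLine a χ k x) = rhoVAtLine (−a) χ̄ k (J x)` for every `k ∈ U(V)(𝔸_f)` — complex conjugation of finite Schwartz functions,
descended (★ J-a), on the identified mirror splitting (★ J-b, §2).  [Liu2021, App. D Lem. D.1 (2)] at the tree's objects, at the representative `−a`.
[cite: Liu2021, Def. 4.11 (l. 2092–2096), App. D Lemma D.1 (2) (l. 5231), Remark 4.4] [cite: GelbartRogawski1991, §3.1 Prop. 3.1.1 p. 455, Remark p. 457]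
[cite: Li1992, p. 181] -/
theorem exists_conjPartner_omegaAtLine_neg
    (μ : Literature.NumberTheory.Automorphic.IdeleClassGroup (L : Type) →ₜ* Circle) (hμ : IsConjugateSymplectic (L : Type) μ)
    (hw : HasWeight (L : Type) μ 1) {Φ : Literature.AlgebraicGeometry.Motives.CMType (L : Type)} (hΦμ : HasCMType (L : Type) μ Φ)
    (hμs : IsSplittingChar (L : Type) 1 (toHeckeCharacter (L : Type) μ)) (a : (↥(maximalRealSubfield (L : Type)))ˣ)
    (χ : Chi ↥(maximalRealSubfield (L : Type)) (L : Type) (IsCMField.complexConj (L : Type))) :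
    ∃ (μ' : Literature.NumberTheory.Automorphic.IdeleClassGroup (L : Type) →ₜ* Circle) (hμ' : IsConjugateSymplectic (L : Type) μ'),
      HasWeight (L : Type) μ' 1 ∧ HasCMType (L : Type) μ' (bar Φ) ∧
      ∃ J : omegaAtLine ↥(maximalRealSubfield (L : Type)) (L : Type) (IsCMField.complexConj (L : Type)) 3 e₁ (Matrix.diagonal (frameD V))
            (complexConj_imagUnit (L : Type)) (imagUnit_ne_zero (L : Type)) (imagUnit_mul_self (L : Type))
            (realDiagonal_isSymm (L : Type) (frameD V) (frameD_real V)) (isUnit_det_realDiagonal (L : Type) (frameD V) (frameD_real V) (frameD_ne V))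
            (realDiagonal_map (L : Type) (frameD V) (frameD_real V)).symm
            (hsChiD (⟨HodgeCM.CMField.K L⟩ : Summit.HodgeConjecture.CorCM.CMField) e₁ (frameD V) (frameD_real V) (frameD_ne V)
              (toHeckeCharacter (L : Type) μ) (isUnitary_toHeckeCharacter (L : Type) μ) hμs) a χ →ₛₗ[starRingEnd ℂ]
          omegaAtLine ↥(maximalRealSubfield (L : Type)) (L : Type) (IsCMField.complexConj (L : Type)) 3 e₁ (Matrix.diagonal (frameD V))
            (complexConj_imagUnit (L : Type)) (imagUnit_ne_zero (L : Type)) (imagUnit_mul_self (L : Type))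
            (realDiagonal_isSymm (L : Type) (frameD V) (frameD_real V)) (isUnit_det_realDiagonal (L : Type) (frameD V) (frameD_real V) (frameD_ne V))
            (realDiagonal_map (L : Type) (frameD V) (frameD_real V)).symm
            (hsChiD (⟨HodgeCM.CMField.K L⟩ : Summit.HodgeConjecture.CorCM.CMField) e₁ (frameD V) (frameD_real V) (frameD_ne V)
              (toHeckeCharacter (L : Type) μ') (isUnitary_toHeckeCharacter (L : Type) μ')
              (isSplittingChar_toHeckeCharacter_of_isConjugateSymplectic (L : Type) μ' hμ')) (-a)
            ⟨(Units.map ((starRingEnd ℂ : ℂ →+* ℂ) : ℂ →* ℂ)).comp χ.1,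
              isAutomorphicOneChar_unitsMap_comp_chi (IsCMField.complexConj (L : Type)) χ _⟩,
        Function.Bijective J ∧
        ∀ (k : finAdelic ↥(maximalRealSubfield (L : Type)) (L : Type) (IsCMField.complexConj (L : Type)) 3 (Matrix.diagonal (frameD V))) x,
          J (rhoVAtLine ↥(maximalRealSubfield (L : Type)) (L : Type) (IsCMField.complexConj (L : Type)) 3 e₁ (Matrix.diagonal (frameD V))
              (complexConj_imagUnit (L : Type)) (imagUnit_ne_zero (L : Type)) (imagUnit_mul_self (L : Type))
              (realDiagonal_isSymm (L : Type) (frameD V) (frameD_real V)) (isUnit_det_realDiagonal (L : Type) (frameD V) (frameD_real V) (frameD_ne V))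
              (realDiagonal_map (L : Type) (frameD V) (frameD_real V)).symm
              (hsChiD (⟨HodgeCM.CMField.K L⟩ : Summit.HodgeConjecture.CorCM.CMField) e₁ (frameD V) (frameD_real V) (frameD_ne V)
                (toHeckeCharacter (L : Type) μ) (isUnitary_toHeckeCharacter (L : Type) μ) hμs) a χ k x) =
            rhoVAtLine ↥(maximalRealSubfield (L : Type)) (L : Type) (IsCMField.complexConj (L : Type)) 3 e₁ (Matrix.diagonal (frameD V))
              (complexConj_imagUnit (L : Type)) (imagUnit_ne_zero (L : Type)) (imagUnit_mul_self (L : Type))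
              (realDiagonal_isSymm (L : Type) (frameD V) (frameD_real V)) (isUnit_det_realDiagonal (L : Type) (frameD V) (frameD_real V) (frameD_ne V))
              (realDiagonal_map (L : Type) (frameD V) (frameD_real V)).symm
              (hsChiD (⟨HodgeCM.CMField.K L⟩ : Summit.HodgeConjecture.CorCM.CMField) e₁ (frameD V) (frameD_real V) (frameD_ne V)
                (toHeckeCharacter (L : Type) μ') (isUnitary_toHeckeCharacter (L : Type) μ')
                (isSplittingChar_toHeckeCharacter_of_isConjugateSymplectic (L : Type) μ' hμ')) (-a)
              ⟨(Units.map ((starRingEnd ℂ : ℂ →+* ℂ) : ℂ →* ℂ)).comp χ.1,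
                isAutomorphicOneChar_unitsMap_comp_chi (IsCMField.complexConj (L : Type)) χ _⟩ k (J x) := by
  -- the splitting-character proof of the statement is the dictionary's (proof irrelevance, made syntactic)
  have hμs_eq : hμs = isSplittingChar_toHeckeCharacter_of_isConjugateSymplectic (L : Type) μ hμ := rfl
  subst hμs_eq
  obtain ⟨μ', hμ', hw', hΦ', hEq⟩ := exists_weightOne_mirror_sChiD V μ hμ hw hΦμ a
  refine ⟨μ', hμ', hw', hΦ', ?_⟩
  obtain ⟨J, hJb, -, hJeq⟩ := exists_coinv_semilinear_mirror_cast ↥(maximalRealSubfield (L : Type)) (L : Type) (IsCMField.complexConj (L : Type))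
    3 1 e₁ (Matrix.diagonal (frameD V)) (JW ↥(maximalRealSubfield (L : Type)) (L : Type) a)
    (complexConj_imagUnit (L : Type)) (imagUnit_ne_zero (L : Type)) (imagUnit_mul_self (L : Type))
    (realDiagonal_isSymm (L : Type) (frameD V) (frameD_real V)) (isSymm_TW ↥(maximalRealSubfield (L : Type)) a)
    (isUnit_det_realDiagonal (L : Type) (frameD V) (frameD_real V) (frameD_ne V)) (isUnit_det_TW ↥(maximalRealSubfield (L : Type)) a)
    (realDiagonal_map (L : Type) (frameD V) (frameD_real V)).symm (JW_eq ↥(maximalRealSubfield (L : Type)) (L : Type) a)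
    (hsChiD (⟨HodgeCM.CMField.K L⟩ : Summit.HodgeConjecture.CorCM.CMField) e₁ (frameD V) (frameD_real V) (frameD_ne V)
      (toHeckeCharacter (L : Type) μ) (isUnitary_toHeckeCharacter (L : Type) μ)
      (isSplittingChar_toHeckeCharacter_of_isConjugateSymplectic (L : Type) μ hμ) a)
    (neg_TW_eq a) (neg_JW_eq a) (isSymm_TW ↥(maximalRealSubfield (L : Type)) (-a)) (isUnit_det_TW ↥(maximalRealSubfield (L : Type)) (-a))
    (JW_eq ↥(maximalRealSubfield (L : Type)) (L : Type) (-a)) _ hEq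
    (hsChiD (⟨HodgeCM.CMField.K L⟩ : Summit.HodgeConjecture.CorCM.CMField) e₁ (frameD V) (frameD_real V) (frameD_ne V)
      (toHeckeCharacter (L : Type) μ') (isUnitary_toHeckeCharacter (L : Type) μ')
      (isSplittingChar_toHeckeCharacter_of_isConjugateSymplectic (L : Type) μ' hμ') (-a))
    (lineChar ↥(maximalRealSubfield (L : Type)) (L : Type) (IsCMField.complexConj (L : Type)) a χ.1)
    (lineChar ↥(maximalRealSubfield (L : Type)) (L : Type) (IsCMField.complexConj (L : Type)) (-a)
      ((Units.map ((starRingEnd ℂ : ℂ →+* ℂ) : ℂ →* ℂ)).comp χ.1))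
    (fun u u₂ hu => lineChar_eq_of_val_eq ↥(maximalRealSubfield (L : Type)) (L : Type) (IsCMField.complexConj (L : Type)) a (-a) χ.1
      ((starRingEnd ℂ : ℂ →+* ℂ) : ℂ →* ℂ) u u₂ hu)
  exact ⟨J, hJb, hJeq⟩

end Partner

end Summit.HodgeConjecture.HodgeConjecture.Cruxes.H413.MirrorAtPinLine

end
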